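import Summits.BirchSwinnertonDyer.BirchSwinnertonDyer.Theorems.EisensteinPrimesWeakLeopoldtAbove
import Summits.BirchSwinnertonDyer.BirchSwinnertonDyer.Theorems.EisensteinPrimesAcTwistDeformationSURRank
import HarnessLib

/-!
# Weak Leopoldt on the anticyclotomic line, END TO END modulo the published corank formulas:
# `H²(Gal(K_Σ/K_∞), A) = 0` for `A ≃ₗ (ℚ_p/ℤ_p)ⁿ` (characters `n = 1`, `E[p^∞]` `n = 2`) from the corank SQUEEZE
# (cell `bsd-eis`, seat `bsd-line-x1-p1-w2` gen 4; crux 2 `GoodLatticeBDPValue` stmt-BirchSwinnertonDyer-19032, line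
# `halves`, V21 road input WL_A)

HONEST FRAMING (cell `bsd-eis`, run/shared/lean/pub/bsd-eis/): theorems only (no definition, no named fact, no `sorry`,
no `Theses` import); the PUBLISHED facts Greenberg 2006 Props. 4.1, 4.2, §5 A, 3.2 (`prop41_…`, `prop42_…`, `sec5A_…`,
`prop32_…`) and `cd_p(G_{K,Σ}) ≤ 2` (`groupCdLE_two_galoisGroupUnramifiedOutside`, Harari Cor. 17.14 / NSW (8.3.18)) enter
as HYPOTHESES by name; nothing about any curve is asserted; BSD / IMC2 / KY Thm. 1.4.1 are proved for NO curve here.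
Helper `--supports stmt-BirchSwinnertonDyer-19032`; closes no registered stub.

## What

`…WeakLeopoldtAbove` (this seat, #3) reduced WL_A to `HasCorank Λ ((bigRep κ̄ ρ₀).H 2) 0` (+ CD2 + Prop. 3.2 + cofreeness);
w3 g3's `AcTwistDeformation.bigRep_leo_crk_pi` (p644452) produces exactly that conjunct for `A ≃ₗ[ℤ_p] (ℚ_p/ℤ_p)ⁿ` over a
`ℤ_p`-extension of an IMAGINARY QUADRATIC `K` with `p = 𝔭𝔭̄` split, by cell `bsd-ssimc`'s generic squeeze
`leo_and_crk_fullAt_of_squeeze` (Greenberg 2006 Prop. 4.1: `h⁰ − h¹ + h² = −n`, and `h¹ ≤ corank S_{𝓛_𝔭} + corank Q_{𝓛_𝔭}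
= 0 + n`), from: `h⁰_loc = 0` and LOC⁽¹⁾ at the places of `S`, and `corank_Λ S_{𝓛_𝔭}(K, 𝐃₁) = 0`. THIS FILE composes:

* §1 **`subsingleton_H_two_bigRep_of_squeeze_pi`** / **`subsingleton_H_two_above_of_squeeze_pi`**: for
  `A ≃ₗ[ℤ_p] (ℚ_p/ℤ_p)ⁿ`, the hypotheses of `bigRep_leo_crk_pi` (h41, h42, h5A, h32; `K` imaginary quadratic; `𝔭 ≠ 𝔭̄`
  above `p`; `h⁰_loc = 0` and LOC⁽¹⁾ on `S`; `corank S_{𝓛_𝔭} = 0`) + CD2 + `p ≠ 2` ⟹ `H²(K_Σ/K, 𝐃₁) = 0` and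
  **`H²(Gal(K_Σ/K_∞), A) = 0`** (`Subsingleton ((ρ₀.restrict (galoisGroupAboveSubtype S κ.kerSubgroup)).H 2)`). With
  `n = 2`, `A = E[p^∞]`: WL_f of the V21 road.
* §2 **`subsingleton_H_two_above_of_squeeze_character`**: the CHARACTER case `A ≃ₗ[ℤ_p] ℚ_p/ℤ_p` with `G_{K,S}` acting by
  scalars (`hscalar`) and one `σ_w` per `w ∈ S` with `κ(σ_w) ≠ 1` (`hsup` — no place of `S` splits completely in `K_∞`):
  `h⁰_loc = 0` and LOC⁽¹⁾ are DISCHARGED exactly as in LEAD g2's `bigRep_fullAt_SUR` (`hasCorank_localH0_bigRep_zero`,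
  `bigRep_LOC1`, the Tate dual generator `QpModZp.exists_unitsCarrier_hinj_hsurj_of_linearEquiv`); the hypotheses are
  those of `bigRep_fullAt_SUR` MINUS Prop. 2.6.3 and `hSelfg`, PLUS CD2 and `p ≠ 2`. With `θ ∈ {θsub, θquot}`:
  WL_ω / WL_1 of the V21 road.
* §3 `subsingleton_H_restrict_iff_of_forall_toUnramifiedQuot`: two descents (over any two coefficient rings) of the same
  `Γ_K`-module to `G_{K,S}` have the same `Hⁿ` above `K_∞` — the bridge to w4 g4's `ℤ`-linear descended modules
  (`exists_continuousRep_quot`, `ρ (toUnramifiedQuot K Σ σ) m = σ • m`).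

What remains outside this file (per module `A_?`): the `G_{K,S}`-representation `ρ₀` on the cell's model of `A_?`
(characters: `characterRepUnramified`; curve: bsd-ssimc's `exists_continuousRep_primaryTorsion`), the `σ`-supply /
LOC⁽¹⁾ at the places of `S` (tree: `exists_local_apply_ne_one_of_mem_insert_insert`; w3 g3 `…LOC1Rank` for `E`), and
`corank_Λ S_{𝓛_𝔭}(K, 𝐃₁) = 0` (Rubin–Hida / PW cotorsion transported by Shapiro — the S1/S2 lanes' `hSel`).

References: [Greenberg2006] Thm. 3 p. 342, Props. 3.2–3.6 pp. 358–360, Props. 4.1–4.2 pp. 367–368, §5 A p. 373;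
[Greenberg2016Selmer] §2.2–2.3 pp. 6–7; [Greenberg2010] Lemma 5.2.2; [NeukirchSchmidtWingberg2008] (8.3.18);
[Harari2020] Cor. 17.14; [PollackWeston2011] proof of Prop. A.2; [KellerYin2024] §1.4; the road memo
`Cruxes/GoodLatticeBDPValue/Lines/halves-imprimLambda-index-road.md` §3.
-/

set_option autoImplicit false
set_option linter.dupNamespace false -- the summit namespace `…BirchSwinnertonDyer.BirchSwinnertonDyer.Theorems` (Sub = Summit, D-0017) trips it

noncomputable section

open scoped Classical
open NumberField IsDedekindDomain Field
open Literature.NumberTheory.GaloisRepresentations Literature.NumberTheory.GaloisCohomology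
open Literature.NumberTheory.EllipticCurves (ZpExtension BigRepModule bigRep IsImaginaryQuadratic)
open Literature.NumberTheory.IwasawaTheory Literature.NumberTheory.IwasawaTheory.Greenberg2016
  Literature.NumberTheory.IwasawaTheory.Greenberg2006
open Summit.BirchSwinnertonDyer.BirchSwinnertonDyer.Theorems.AcTwistDeformation
  Summit.BirchSwinnertonDyer.BirchSwinnertonDyer.Theorems.WeakLeopoldtAbove

namespace Summit.BirchSwinnertonDyer.BirchSwinnertonDyer.Theorems.WeakLeopoldtAboveOfSqueeze

variable {K : Type} [Field K] [NumberField K] {S : Set (HeightOneSpectrum (𝓞 K))} {p : ℕ} [Fact p.Prime]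
  {A : Type} [AddCommGroup A] [Module ℤ_[p] A] [TopologicalSpace A] [DiscreteTopology A] [ContinuousSMul ℤ_[p] A]
  [TopologicalSpace (PowerSeries ℤ_[p])] [IsTopologicalRing (PowerSeries ℤ_[p])]
  [IsTopologicalAddGroup (BigRepModule ℤ_[p] p A)]
  [ContinuousSMul (PowerSeries ℤ_[p]) (BigRepModule ℤ_[p] p A)]
  (hS : ∀ v : HeightOneSpectrum (𝓞 K), ((p : ℕ) : 𝓞 K) ∈ v.asIdeal → v ∈ S)
  (κ : ZpExtension K p) (ρ₀ : ContinuousRep (GaloisGroupUnramifiedOutside K S) ℤ_[p] A)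

/-! ## §1 `A ≃ₗ[ℤ_p] (ℚ_p/ℤ_p)ⁿ`: `h⁰_loc = 0` + LOC⁽¹⁾ on `S` + `corank S_{𝓛_𝔭} = 0` ⟹ `H²(K_Σ/K_∞, A) = 0` -/

section Pi

variable {n : ℕ}

omit [ContinuousSMul ℤ_[p] A] in
/-- **`H²(K_Σ/K, 𝐃₁) = 0` from the corank squeeze**, `A ≃ₗ[ℤ_p] (ℚ_p/ℤ_p)ⁿ`, `K` imaginary quadratic with `p = 𝔭𝔭̄`
split: the hypotheses of w3 g3's `bigRep_leo_crk_pi` (Greenberg 2006 Props. 4.1, 4.2, §5 A, 3.2 by name; `h⁰_loc = 0`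
and LOC⁽¹⁾ at the places of `S`; `corank_Λ S_{𝓛_𝔭}(K, 𝐃₁) = 0`) give `corank H²(K_Σ/K, 𝐃₁) = 0`, and `cd_p(G_{K,Σ}) ≤ 2`
(PUB, `p ≠ 2`) with cofreeness of `𝐃₁` upgrades it to vanishing (`…WeakLeopoldtAbove`).
[cite: Greenberg2006, Props. 4.1–4.2 (§4 A pp. 367–368), §5 A, Props. 3.2–3.6 pp. 358–360]
[cite: Greenberg2016Selmer, §2.2–2.3 pp. 6–7] [cite: NeukirchSchmidtWingberg2008, (8.3.18)] -/
theorem subsingleton_H_two_bigRep_of_squeeze_pi (hCD2 : groupCdLE_two_galoisGroupUnramifiedOutside K)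
    (h41 : prop41_globalEulerPoincareCorank) (h42 : prop42_localEulerPoincareCorank)
    (h5A : sec5A_localH2_subsingleton_of_LOC1) (h32 : prop32_cohomology_isCofinitelyGenerated) (hp2 : p ≠ 2)
    (hSf : S.Finite) (hK : IsImaginaryQuadratic K) (e : A ≃ₗ[ℤ_[p]] (Fin n → QpModZp p))
    (h0loc : ∀ v : HeightOneSpectrum (𝓞 K), v ∈ S →
      HasCorank (PowerSeries ℤ_[p])
        ((localRep S (bigRep (κ.liftUnramifiedOutside S hS) ρ₀) (Sum.inr v)).H 0) 0)
    (hLOC1fin : ∀ v : HeightOneSpectrum (𝓞 K), v ∈ S →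
      LOC1 S (bigRep (κ.liftUnramifiedOutside S hS) ρ₀) (Sum.inr v))
    {𝔭 𝔭bar : HeightOneSpectrum (𝓞 K)} (hne : 𝔭bar ≠ 𝔭)
    (hp𝔭 : ((p : ℕ) : 𝓞 K) ∈ 𝔭.asIdeal) (hp𝔭bar : ((p : ℕ) : 𝓞 K) ∈ 𝔭bar.asIdeal)
    (hSel : HasCorank (PowerSeries ℤ_[p])
      (fullAtSpecification S (bigRep (κ.liftUnramifiedOutside S hS) ρ₀) (Sum.inr 𝔭)).selmer 0) :
    Subsingleton ((bigRep (κ.liftUnramifiedOutside S hS) ρ₀).H 2) := by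
  obtain ⟨hA, jQ, hinj, hsurj⟩ := exists_pi_character_hinj_hsurj_of_linearEquiv e
  exact subsingleton_H_two_bigRep_of_facts S hS κ ρ₀ hCD2 h32 hp2 hSf (isCofree_bigRepModule_pi hA jQ hinj hsurj)
    (bigRep_leo_crk_pi hS κ ρ₀ h41 h42 h5A h32 hSf hK e h0loc hLOC1fin hne hp𝔭 hp𝔭bar hSel).2.2.2

/-- **WEAK LEOPOLDT ABOVE `K_∞` FROM THE SQUEEZE, `A ≃ₗ[ℤ_p] (ℚ_p/ℤ_p)ⁿ`: `H²(Gal(K_Σ/K_∞), A) = 0`** (e.g. `A = E[p^∞]`,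
`n = 2`: WL_f of the V21 road), under the hypotheses of `bigRep_leo_crk_pi` + CD2 + `p ≠ 2`.
[cite: Greenberg2006, Thm. 3 p. 342, Props. 4.1–4.2 pp. 367–368, §5 A, Props. 3.2–3.6 pp. 358–360]
[cite: Greenberg2016Selmer, §2.2–2.3 pp. 6–7] [cite: NeukirchSchmidtWingberg2008, (8.3.18)] -/
theorem subsingleton_H_two_above_of_squeeze_pi (hCD2 : groupCdLE_two_galoisGroupUnramifiedOutside K)
    (h41 : prop41_globalEulerPoincareCorank) (h42 : prop42_localEulerPoincareCorank)
    (h5A : sec5A_localH2_subsingleton_of_LOC1) (h32 : prop32_cohomology_isCofinitelyGenerated) (hp2 : p ≠ 2)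
    (hSf : S.Finite) (hK : IsImaginaryQuadratic K) (e : A ≃ₗ[ℤ_[p]] (Fin n → QpModZp p))
    (h0loc : ∀ v : HeightOneSpectrum (𝓞 K), v ∈ S →
      HasCorank (PowerSeries ℤ_[p])
        ((localRep S (bigRep (κ.liftUnramifiedOutside S hS) ρ₀) (Sum.inr v)).H 0) 0)
    (hLOC1fin : ∀ v : HeightOneSpectrum (𝓞 K), v ∈ S →
      LOC1 S (bigRep (κ.liftUnramifiedOutside S hS) ρ₀) (Sum.inr v))
    {𝔭 𝔭bar : HeightOneSpectrum (𝓞 K)} (hne : 𝔭bar ≠ 𝔭)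
    (hp𝔭 : ((p : ℕ) : 𝓞 K) ∈ 𝔭.asIdeal) (hp𝔭bar : ((p : ℕ) : 𝓞 K) ∈ 𝔭bar.asIdeal)
    (hSel : HasCorank (PowerSeries ℤ_[p])
      (fullAtSpecification S (bigRep (κ.liftUnramifiedOutside S hS) ρ₀) (Sum.inr 𝔭)).selmer 0) :
    Subsingleton ((ρ₀.restrict (galoisGroupAboveSubtype S κ.kerSubgroup)).H 2) :=
  subsingleton_H_two_above_of_linearEquiv_pi S hS κ ρ₀ hCD2 h32 hp2 hSf e
    (bigRep_leo_crk_pi hS κ ρ₀ h41 h42 h5A h32 hSf hK e h0loc hLOC1fin hne hp𝔭 hp𝔭bar hSel).2.2.2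

end Pi

/-! ## §2 The CHARACTER case `A ≃ₗ[ℤ_p] ℚ_p/ℤ_p`, `G_{K,S}` acting by scalars: `h⁰_loc` and LOC⁽¹⁾ discharged -/

section Character

omit [TopologicalSpace A] [DiscreteTopology A] [ContinuousSMul ℤ_[p] A] [TopologicalSpace (PowerSeries ℤ_[p])]
  [IsTopologicalRing (PowerSeries ℤ_[p])] [IsTopologicalAddGroup (BigRepModule ℤ_[p] p A)]
  [ContinuousSMul (PowerSeries ℤ_[p]) (BigRepModule ℤ_[p] p A)] in
/-- `ℚ_p/ℤ_p ≃ₗ (Fin 1 → ℚ_p/ℤ_p)`: a corank-one `A` is a corank-`n` `A` with `n = 1`. [folklore] -/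
theorem nonempty_linearEquiv_pi_one (e : A ≃ₗ[ℤ_[p]] QpModZp p) : Nonempty (A ≃ₗ[ℤ_[p]] (Fin 1 → QpModZp p)) :=
  ⟨e.trans (LinearEquiv.funUnique (Fin 1) ℤ_[p] (QpModZp p)).symm⟩

omit [ContinuousSMul ℤ_[p] A] [IsTopologicalRing (PowerSeries ℤ_[p])] in
/-- **`h⁰_loc = 0` and LOC⁽¹⁾ at every place of `S` for the twist deformation of a CHARACTER**, from the scalar action
(`hscalar`) and one `σ_w` per `w ∈ S` with `κ(σ_w) ≠ 1` (`hsup`) — LEAD g2's `hasCorank_localH0_bigRep_zero` and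
`bigRep_LOC1` ([Greenberg2010] Lemma 5.2.2), with the Tate dual generator of `A ≃ ℚ_p/ℤ_p` over `K̄ˣ`.
[cite: Greenberg2010, Lemma 5.2.2 (PDF p. 28)] [cite: Greenberg2006, §5 A (p. 373)] -/
theorem h0loc_and_LOC1_of_scalar (e : A ≃ₗ[ℤ_[p]] QpModZp p)
    (hscalar : ∀ g : GaloisGroupUnramifiedOutside K S, ∃ t : ℤ_[p]ˣ, ∀ a : A, ρ₀ g a = (t : ℤ_[p]) • a)
    (hsup : ∀ v : HeightOneSpectrum (𝓞 K), v ∈ S →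
      ∃ σ : absoluteGaloisGroup (Place.Completion (Sum.inr v : Place K)), κ (absGaloisRestrict K _ σ) ≠ 1) :
    (∀ v : HeightOneSpectrum (𝓞 K), v ∈ S →
      HasCorank (PowerSeries ℤ_[p])
        ((localRep S (bigRep (κ.liftUnramifiedOutside S hS) ρ₀) (Sum.inr v)).H 0) 0) ∧
    (∀ v : HeightOneSpectrum (𝓞 K), v ∈ S → LOC1 S (bigRep (κ.liftUnramifiedOutside S hS) ρ₀) (Sum.inr v)) := by
  obtain ⟨hA, -, -, -, -⟩ := QpModZp.exists_character_hinj_hsurj_of_linearEquiv e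
  obtain ⟨jU, -, hinjU, hsurjU⟩ := QpModZp.exists_unitsCarrier_hinj_hsurj_of_linearEquiv K e
  refine ⟨fun v hv ↦ ?_, fun v hv ↦ ?_⟩
  · obtain ⟨σ, hσ⟩ := hsup v hv
    exact hasCorank_localH0_bigRep_zero S hS κ ρ₀ hscalar (Sum.inr v) hσ
  · obtain ⟨σ, hσ⟩ := hsup v hv
    obtain ⟨t, ht⟩ := hscalar (localToUnramified S (Sum.inr v) σ)
    obtain ⟨u, hu⟩ := QpModZp.exists_units_apply_eq_smul K jU hsurjU (absGaloisRestrict K _ σ)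
    exact bigRep_LOC1 S hS κ ρ₀ hA jU hinjU hsurjU (Sum.inr v) σ t ht hu hσ

/-- **WEAK LEOPOLDT ABOVE `K_∞` FOR A CHARACTER, from the squeeze: `H²(Gal(K_Σ/K_∞), A) = 0`** for `A ≃ₗ[ℤ_p] ℚ_p/ℤ_p`
on which `G_{K,S}` acts by scalars (e.g. `ℚ_p/ℤ_p(θ) ≅ (F/𝒪)(θ)`, `θ ∈ {θsub, θquot}`: WL_ω / WL_1 of the V21 road),
over a `ℤ_p`-extension `κ` of an IMAGINARY QUADRATIC `K` with `p = 𝔭𝔭̄` split, no place of `S` splitting completely in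
`K_∞` (`hsup`), granted Greenberg 2006 Props. 4.1, 4.2, §5 A, 3.2 and CD2 BY NAME and `corank_Λ S_{𝓛_𝔭}(K, 𝐃₁) = 0`
— i.e. the hypotheses of LEAD g2's `bigRep_fullAt_SUR` minus Prop. 2.6.3 / `hSelfg`, plus CD2 / `p ≠ 2`.
[cite: Greenberg2006, Thm. 3 p. 342, Props. 4.1–4.2 pp. 367–368, §5 A, Props. 3.2–3.6 pp. 358–360]
[cite: Greenberg2016Selmer, §2.2–2.3 pp. 6–7] [cite: Greenberg2010, Lemma 5.2.2] [cite: NeukirchSchmidtWingberg2008, (8.3.18)] -/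
theorem subsingleton_H_two_above_of_squeeze_character (hCD2 : groupCdLE_two_galoisGroupUnramifiedOutside K)
    (h41 : prop41_globalEulerPoincareCorank) (h42 : prop42_localEulerPoincareCorank)
    (h5A : sec5A_localH2_subsingleton_of_LOC1) (h32 : prop32_cohomology_isCofinitelyGenerated) (hp2 : p ≠ 2)
    (hSf : S.Finite) (hK : IsImaginaryQuadratic K) (e : A ≃ₗ[ℤ_[p]] QpModZp p)
    (hscalar : ∀ g : GaloisGroupUnramifiedOutside K S, ∃ t : ℤ_[p]ˣ, ∀ a : A, ρ₀ g a = (t : ℤ_[p]) • a)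
    (hsup : ∀ v : HeightOneSpectrum (𝓞 K), v ∈ S →
      ∃ σ : absoluteGaloisGroup (Place.Completion (Sum.inr v : Place K)), κ (absGaloisRestrict K _ σ) ≠ 1)
    {𝔭 𝔭bar : HeightOneSpectrum (𝓞 K)} (hne : 𝔭bar ≠ 𝔭)
    (hp𝔭 : ((p : ℕ) : 𝓞 K) ∈ 𝔭.asIdeal) (hp𝔭bar : ((p : ℕ) : 𝓞 K) ∈ 𝔭bar.asIdeal)
    (hSel : HasCorank (PowerSeries ℤ_[p])
      (fullAtSpecification S (bigRep (κ.liftUnramifiedOutside S hS) ρ₀) (Sum.inr 𝔭)).selmer 0) :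
    Subsingleton ((ρ₀.restrict (galoisGroupAboveSubtype S κ.kerSubgroup)).H 2) := by
  obtain ⟨e₁⟩ := nonempty_linearEquiv_pi_one e
  obtain ⟨h0loc, hLOC1fin⟩ := h0loc_and_LOC1_of_scalar hS κ ρ₀ e hscalar hsup
  exact subsingleton_H_two_above_of_squeeze_pi hS κ ρ₀ hCD2 h41 h42 h5A h32 hp2 hSf hK e₁ h0loc hLOC1fin hne hp𝔭
    hp𝔭bar hSel

omit [ContinuousSMul ℤ_[p] A] in
/-- The `K`-side form for a character: **`H²(K_Σ/K, 𝐃₁) = 0`** under the same hypotheses.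
[cite: Greenberg2006, Props. 4.1–4.2 pp. 367–368, §5 A, Props. 3.2–3.6 pp. 358–360] [cite: Greenberg2016Selmer, §2.2–2.3 pp. 6–7] -/
theorem subsingleton_H_two_bigRep_of_squeeze_character (hCD2 : groupCdLE_two_galoisGroupUnramifiedOutside K)
    (h41 : prop41_globalEulerPoincareCorank) (h42 : prop42_localEulerPoincareCorank)
    (h5A : sec5A_localH2_subsingleton_of_LOC1) (h32 : prop32_cohomology_isCofinitelyGenerated) (hp2 : p ≠ 2)
    (hSf : S.Finite) (hK : IsImaginaryQuadratic K) (e : A ≃ₗ[ℤ_[p]] QpModZp p)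
    (hscalar : ∀ g : GaloisGroupUnramifiedOutside K S, ∃ t : ℤ_[p]ˣ, ∀ a : A, ρ₀ g a = (t : ℤ_[p]) • a)
    (hsup : ∀ v : HeightOneSpectrum (𝓞 K), v ∈ S →
      ∃ σ : absoluteGaloisGroup (Place.Completion (Sum.inr v : Place K)), κ (absGaloisRestrict K _ σ) ≠ 1)
    {𝔭 𝔭bar : HeightOneSpectrum (𝓞 K)} (hne : 𝔭bar ≠ 𝔭)
    (hp𝔭 : ((p : ℕ) : 𝓞 K) ∈ 𝔭.asIdeal) (hp𝔭bar : ((p : ℕ) : 𝓞 K) ∈ 𝔭bar.asIdeal)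
    (hSel : HasCorank (PowerSeries ℤ_[p])
      (fullAtSpecification S (bigRep (κ.liftUnramifiedOutside S hS) ρ₀) (Sum.inr 𝔭)).selmer 0) :
    Subsingleton ((bigRep (κ.liftUnramifiedOutside S hS) ρ₀).H 2) := by
  obtain ⟨e₁⟩ := nonempty_linearEquiv_pi_one e
  obtain ⟨h0loc, hLOC1fin⟩ := h0loc_and_LOC1_of_scalar hS κ ρ₀ e hscalar hsup
  exact subsingleton_H_two_bigRep_of_squeeze_pi hS κ ρ₀ hCD2 h41 h42 h5A h32 hp2 hSf hK e₁ h0loc hLOC1fin hne hp𝔭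
    hp𝔭bar hSel

end Character

/-! ## §3 Two descents of the same `Γ_K`-module to `G_{K,S}` have the same cohomology above `K_∞` -/

omit [NumberField K] [Module ℤ_[p] A] [DiscreteTopology A] [ContinuousSMul ℤ_[p] A] [TopologicalSpace (PowerSeries ℤ_[p])]
  [IsTopologicalRing (PowerSeries ℤ_[p])] [IsTopologicalAddGroup (BigRepModule ℤ_[p] p A)]
  [ContinuousSMul (PowerSeries ℤ_[p]) (BigRepModule ℤ_[p] p A)] in
/-- **Uniqueness of the descent, read on cohomology**: two continuous `G_{K,S}`-representations on the SAME topological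
group `A`, over ANY two coefficient rings (e.g. this file's `ℤ_p`-linear `ρ₀` and w4 g4's `ℤ`-linear descent of a
`Γ_K`-module `M` with `ρ (toUnramifiedQuot K S σ) m = σ • m`), which agree on the classes of `Γ_K` — hence everywhere,
`Γ_K ↠ G_{K,S}` — have the same `Hⁿ` after restriction along any `φ : H →ₜ* G_{K,S}` (in particular on
`Gal(K_Σ/K_∞) = galoisGroupAbove S κ.kerSubgroup`): the currency bridge of `…WeakLeopoldtAbove` §4 at `η = id`.
[cite: Brown1982CohomologyGroups, III.1 Example 3] [cite: Greenberg2006, p. 341 L12–16] -/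
theorem subsingleton_H_restrict_iff_of_forall_toUnramifiedQuot [IsTopologicalAddGroup A]
    {R₁ : Type} [CommRing R₁] [TopologicalSpace R₁] [Module R₁ A] [ContinuousSMul R₁ A]
    {R₂ : Type} [CommRing R₂] [TopologicalSpace R₂] [Module R₂ A] [ContinuousSMul R₂ A]
    (ρ₁ : ContinuousRep (GaloisGroupUnramifiedOutside K S) R₁ A) (ρ₂ : ContinuousRep (GaloisGroupUnramifiedOutside K S) R₂ A)
    (h : ∀ (σ : absoluteGaloisGroup K) (a : A), ρ₁ (toUnramifiedQuot K S σ) a = ρ₂ (toUnramifiedQuot K S σ) a)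
    {H : Type} [Group H] [TopologicalSpace H] [IsTopologicalGroup H]
    (φ : H →ₜ* GaloisGroupUnramifiedOutside K S) (n : ℕ) :
    Subsingleton ((ρ₁.restrict φ).H n) ↔ Subsingleton ((ρ₂.restrict φ).H n) :=
  subsingleton_H_restrict_iff_of_continuousAddEquiv ρ₁ ρ₂ (ContinuousAddEquiv.refl A) (fun g a ↦ by
    obtain ⟨σ, rfl⟩ := toUnramifiedQuot_surjective K S g
    exact h σ a) φ n

end Summit.BirchSwinnertonDyer.BirchSwinnertonDyer.Theorems.WeakLeopoldtAboveOfSqueeze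

end
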